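import Literature.AlgebraicGeometry.Modules.PullbackAffineChart
import Literature.AlgebraicGeometry.Modules.DualSectionsEquiv
import HarnessLib

/-!
# Pseudofunctor coherence of `f^*` on unit sections: the `pullbackComp ≪≫ pullbackCongr` isomorphisms of three
# composable base changes commute (generic; PART C of the (1b) adapter)

For `YC —g→ YB —fB→ YA —hA→ Z`, a module `M` on `Z`, and the composite-pullback identifications of the shape
`c(g, h, e) := pullbackComp g h ≪≫ pullbackCongr e : g^*(h^*M) ≅ h'^*M` (`e : g ≫ h = h'`) — the shape of
B-p01's `FBIso` and of B-p10's `pullSec` — the square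
`c(fC, hA)⁻¹ ∘ c(g, hB) ∘ η_g = c(g, fB) ∘ η_g ∘ c(fB, hA)⁻¹` holds on global sections (`coherence_unitSection_top`).
Proof: two-level extensionality on `g^*((fB ≫ hA)^*M)` (★ `pullback_pullback_hom_ext_unitSection`) and the unit-section
formulas ★ `pullbackComp_{hom,inv}_app_unitSection`, ★ `pullback_map_app_unitSection`; `pullbackCongr rfl = Iso.refl`.
Everything generic (scheme and module VARIABLES), Mathlib + ★ `Modules/PullbackAffineChart` + ★ `Modules/DualSectionsEquiv`.
Also: the fully respelled variant `coherence_unitSection_top_heq` (every module / isomorphism a free variable pinned by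
equations, so that instantiations reproduce third-party spellings token for token) and `unitSectionLE_le_top`.
(Cell `hodgecm-mathlib`, M13 node N1 (1b), kernel-representation adapter; author B-p04 (g15).)

## References
* [Hartshorne1977] R. Hartshorne, *Algebraic Geometry* (1977), II.5 (p. 110) (`f^*`, adjunction).
* [StacksProject] Tag 01CM.
-/

set_option autoImplicit false

noncomputable section

set_option backward.isDefEq.respectTransparency false

universe u

open CategoryTheory AlgebraicGeometry Opposite TopologicalSpace

namespace Literature.AlgebraicGeometry.Modules

open Literature.AlgebraicGeometry.Motives

variable {Z YA YB YC : Scheme.{u}}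

/-- The `pullbackComp ≪≫ pullbackCongr` identification `g^*(h^*M) ≅ h'^*M` for `e : g ≫ h = h'` (the shape of
B-p01's `FBIso` and B-p10's `pullSec`; non-Prop plumbing). [cite: Hartshorne1977, II.5 (p. 110)] -/
abbrev compCongrIso (g : YC ⟶ YB) (h : YB ⟶ Z) {h' : YC ⟶ Z} (e : g ≫ h = h') (M : Z.Modules) :
    (Scheme.Modules.pullback g).obj ((Scheme.Modules.pullback h).obj M) ≅ (Scheme.Modules.pullback h').obj M :=
  (Scheme.Modules.pullbackComp g h).app M ≪≫ (Scheme.Modules.pullbackCongr e).app M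

/-- `pullbackCongr rfl` is the identity. [folklore] [cite: Hartshorne1977, II.5 (p. 110)] -/
theorem pullbackCongr_rfl {X Y : Scheme.{u}} (f : X ⟶ Y) :
    Scheme.Modules.pullbackCongr (rfl : f = f) = Iso.refl _ := rfl

/-- With `e = rfl`, `c(g, h, rfl).hom = pullbackComp.hom`. [folklore] [cite: Hartshorne1977, II.5 (p. 110)] -/
theorem compCongrIso_rfl_hom (g : YC ⟶ YB) (h : YB ⟶ Z) (M : Z.Modules) :
    (compCongrIso g h rfl M).hom = (Scheme.Modules.pullbackComp g h).hom.app M := by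
  rw [Iso.trans_hom, pullbackCongr_rfl, Iso.app_hom, Iso.app_hom, Iso.refl_hom, NatTrans.id_app,
    Category.comp_id]

/-- With `e = rfl`, `c(g, h, rfl).inv = pullbackComp.inv`. [folklore] [cite: Hartshorne1977, II.5 (p. 110)] -/
theorem compCongrIso_rfl_inv (g : YC ⟶ YB) (h : YB ⟶ Z) (M : Z.Modules) :
    (compCongrIso g h rfl M).inv = (Scheme.Modules.pullbackComp g h).inv.app M := by
  rw [Iso.trans_inv, pullbackCongr_rfl, Iso.app_inv, Iso.app_inv, Iso.refl_inv, NatTrans.id_app,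
    Category.id_comp]

/-- With `e = rfl`, `c(g, h, rfl)` sends `η_g(η_h(m))` to `η_{g ≫ h}(m)`. [cite: Hartshorne1977, II.5 (p. 110)] -/
theorem compCongrIso_rfl_hom_app_unitSection (g : YC ⟶ YB) (h : YB ⟶ Z) (M : Z.Modules) (V : Z.Opens)
    (m : Γ(M, V)) :
    (compCongrIso g h rfl M).hom.app (g ⁻¹ᵁ (h ⁻¹ᵁ V))
        (unitSection g ((Scheme.Modules.pullback h).obj M) (h ⁻¹ᵁ V) (unitSection h M V m)) =
      unitSection (g ≫ h) M V m :=
  (congrArg (fun ψ => Scheme.Modules.Hom.app ψ (g ⁻¹ᵁ (h ⁻¹ᵁ V))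
      (unitSection g ((Scheme.Modules.pullback h).obj M) (h ⁻¹ᵁ V) (unitSection h M V m)))
    (compCongrIso_rfl_hom g h M)).trans (pullbackComp_hom_app_unitSection h M g V m)

/-- With `e = rfl`, `c(g, h, rfl)⁻¹` sends `η_{g ≫ h}(m)` to `η_g(η_h(m))`. [cite: Hartshorne1977, II.5 (p. 110)] -/
theorem compCongrIso_rfl_inv_app_unitSection (g : YC ⟶ YB) (h : YB ⟶ Z) (M : Z.Modules) (V : Z.Opens)
    (m : Γ(M, V)) :
    (compCongrIso g h rfl M).inv.app (g ⁻¹ᵁ (h ⁻¹ᵁ V)) (unitSection (g ≫ h) M V m) =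
      unitSection g ((Scheme.Modules.pullback h).obj M) (h ⁻¹ᵁ V) (unitSection h M V m) :=
  (congrArg (fun ψ => Scheme.Modules.Hom.app ψ (g ⁻¹ᵁ (h ⁻¹ᵁ V)) (unitSection (g ≫ h) M V m))
    (compCongrIso_rfl_inv g h M)).trans (pullbackComp_inv_app_unitSection h M g V m)

/-- An `eqToHom` from an open to itself acts as the identity on sections (Mathlib `eqToHom_refl`). [folklore] [cite: Hartshorne1977, II.5 (p. 110)] -/
theorem presheaf_map_eqToHom_self {X : Scheme.{u}} (N : X.Modules) {U : X.Opens} (q : U = U)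
    (x : Γ(N, U)) : N.presheaf.map (eqToHom q).op x = x := by
  rw [eqToHom_refl, op_id, CategoryTheory.Functor.map_id]
  rfl

/-- `c(g, h, e)` sends `η_g(η_h(m))` to `η_{h'}(m)` when the opens `(g ≫ h)⁻¹V` and `h'⁻¹V` agree definitionally — stated
for `h' := h₁ ≫ h₂` against `g ≫ h = h₁ ≫ h₂` with the SAME preimage open (the associativity instance used below).
[cite: Hartshorne1977, II.5 (p. 110)] -/
theorem compCongrIso_hom_app_unitSection_assoc (g : YC ⟶ YB) (fB : YB ⟶ YA) (hA : YA ⟶ Z)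
    (e : g ≫ fB ≫ hA = (g ≫ fB) ≫ hA) (M : Z.Modules) (V : Z.Opens) (m : Γ(M, V)) :
    (compCongrIso g (fB ≫ hA) e M).hom.app (g ⁻¹ᵁ ((fB ≫ hA) ⁻¹ᵁ V))
        (unitSection g ((Scheme.Modules.pullback (fB ≫ hA)).obj M) ((fB ≫ hA) ⁻¹ᵁ V)
          (unitSection (fB ≫ hA) M V m)) =
      unitSection ((g ≫ fB) ≫ hA) M V m := by
  have a := pullbackComp_hom_app_unitSection (fB ≫ hA) M g V m
  have b := pullbackCongr_hom_app_unitSection (M := M) e V m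
  have c := presheaf_map_eqToHom_self ((Scheme.Modules.pullback ((g ≫ fB) ≫ hA)).obj M)
    (U := ((g ≫ fB) ≫ hA) ⁻¹ᵁ V) (e ▸ rfl) (unitSection ((g ≫ fB) ≫ hA) M V m)
  have hc := congrArg (fun ψ => Scheme.Modules.Hom.app ψ (g ⁻¹ᵁ ((fB ≫ hA) ⁻¹ᵁ V))
      (unitSection g ((Scheme.Modules.pullback (fB ≫ hA)).obj M) ((fB ≫ hA) ⁻¹ᵁ V)
        (unitSection (fB ≫ hA) M V m)))
    (Iso.trans_hom ((Scheme.Modules.pullbackComp g (fB ≫ hA)).app M) ((Scheme.Modules.pullbackCongr e).app M))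
  simp only [Scheme.Modules.Hom.comp_app] at hc
  refine hc.trans ?_
  change ((Scheme.Modules.pullbackCongr e).hom.app M).app _
      (((Scheme.Modules.pullbackComp g (fB ≫ hA)).hom.app M).app _
        (unitSection g ((Scheme.Modules.pullback (fB ≫ hA)).obj M) ((fB ≫ hA) ⁻¹ᵁ V)
          (unitSection (fB ≫ hA) M V m))) = _
  exact ((congrArg (fun y => ((Scheme.Modules.pullbackCongr e).hom.app M).app _ y) a).trans b).trans c

/-- **Coherence on global sections** (the `FBIso`/`pullSec` square of the (1b) adapter): for
`YC —g→ YB —fB→ YA —hA→ Z` with `hB = fB ≫ hA`, `fC = g ≫ fB`, `hC = fC ≫ hA` (up to the given equalities) and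
`s ∈ Γ(hB^*M, ⊤)`,
`c(fC, hA)⁻¹ (c(g, hB) (η_g s)) = c(g, fB) (η_g (c(fB, hA)⁻¹ s))` in `Γ(fC^*(hA^*M), ⊤)`.
[cite: Hartshorne1977, II.5 (p. 110)] [cite: StacksProject, Tag 01CM] -/
theorem coherence_unitSection_top (hA : YA ⟶ Z) (fB : YB ⟶ YA) (g : YC ⟶ YB) {hB : YB ⟶ Z}
    (eqB : fB ≫ hA = hB) {fC : YC ⟶ YA} (eqF : g ≫ fB = fC) {hC : YC ⟶ Z} (eqC : fC ≫ hA = hC)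
    (eqφ : g ≫ hB = hC) (M : Z.Modules)
    (s : Γ((Scheme.Modules.pullback hB).obj M, (⊤ : YB.Opens))) :
    (compCongrIso fC hA eqC M).inv.app ⊤
        ((compCongrIso g hB eqφ M).hom.app ⊤
          (unitSection g ((Scheme.Modules.pullback hB).obj M) ⊤ s)) =
      (compCongrIso g fB eqF ((Scheme.Modules.pullback hA).obj M)).hom.app ⊤
        (unitSection g ((Scheme.Modules.pullback fB).obj ((Scheme.Modules.pullback hA).obj M)) ⊤
          ((compCongrIso fB hA eqB M).inv.app ⊤ s)) := by
  subst eqB eqF eqC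
  -- the two composites `g^*((fB ≫ hA)^*M) ⟶ (g ≫ fB)^*(hA^*M)` agree on double unit sections
  have key : (compCongrIso g (fB ≫ hA) eqφ M).hom ≫ (compCongrIso (g ≫ fB) hA rfl M).inv =
      (Scheme.Modules.pullback g).map (compCongrIso fB hA rfl M).inv ≫
        (compCongrIso g fB rfl ((Scheme.Modules.pullback hA).obj M)).hom := by
    apply pullback_pullback_hom_ext_unitSection g (fB ≫ hA)
    intro V m
    -- left composite on `η_g η_{fB ≫ hA} m`
    have L : ((compCongrIso g (fB ≫ hA) eqφ M).hom ≫ (compCongrIso (g ≫ fB) hA rfl M).inv).app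
        (g ⁻¹ᵁ ((fB ≫ hA) ⁻¹ᵁ V))
        (unitSection g ((Scheme.Modules.pullback (fB ≫ hA)).obj M) ((fB ≫ hA) ⁻¹ᵁ V)
          (unitSection (fB ≫ hA) M V m)) =
        unitSection (g ≫ fB) ((Scheme.Modules.pullback hA).obj M) (hA ⁻¹ᵁ V) (unitSection hA M V m) := by
      rw [Scheme.Modules.Hom.comp_app]
      change (compCongrIso (g ≫ fB) hA rfl M).inv.app _ ((compCongrIso g (fB ≫ hA) eqφ M).hom.app _
        (unitSection g ((Scheme.Modules.pullback (fB ≫ hA)).obj M) ((fB ≫ hA) ⁻¹ᵁ V)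
          (unitSection (fB ≫ hA) M V m))) = _
      exact (congrArg (fun y => (compCongrIso (g ≫ fB) hA rfl M).inv.app _ y)
        (compCongrIso_hom_app_unitSection_assoc g fB hA eqφ M V m)).trans
          (compCongrIso_rfl_inv_app_unitSection (g ≫ fB) hA M V m)
    -- right composite on `η_g η_{fB ≫ hA} m`
    have r1 := pullback_map_app_unitSection g (compCongrIso fB hA rfl M).inv ((fB ≫ hA) ⁻¹ᵁ V)
      (unitSection (fB ≫ hA) M V m)
    have r2 := compCongrIso_rfl_inv_app_unitSection fB hA M V m
    have r3 := compCongrIso_rfl_hom_app_unitSection g fB ((Scheme.Modules.pullback hA).obj M) (hA ⁻¹ᵁ V)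
      (unitSection hA M V m)
    have R : ((Scheme.Modules.pullback g).map (compCongrIso fB hA rfl M).inv ≫
          (compCongrIso g fB rfl ((Scheme.Modules.pullback hA).obj M)).hom).app
        (g ⁻¹ᵁ ((fB ≫ hA) ⁻¹ᵁ V))
        (unitSection g ((Scheme.Modules.pullback (fB ≫ hA)).obj M) ((fB ≫ hA) ⁻¹ᵁ V)
          (unitSection (fB ≫ hA) M V m)) =
        unitSection (g ≫ fB) ((Scheme.Modules.pullback hA).obj M) (hA ⁻¹ᵁ V) (unitSection hA M V m) := by
      rw [Scheme.Modules.Hom.comp_app]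
      change (compCongrIso g fB rfl ((Scheme.Modules.pullback hA).obj M)).hom.app _
        (((Scheme.Modules.pullback g).map (compCongrIso fB hA rfl M).inv).app _
          (unitSection g ((Scheme.Modules.pullback (fB ≫ hA)).obj M) ((fB ≫ hA) ⁻¹ᵁ V)
            (unitSection (fB ≫ hA) M V m))) = _
      have r12 : ((Scheme.Modules.pullback g).map (compCongrIso fB hA rfl M).inv).app _
          (unitSection g ((Scheme.Modules.pullback (fB ≫ hA)).obj M) ((fB ≫ hA) ⁻¹ᵁ V)
            (unitSection (fB ≫ hA) M V m)) =
          unitSection g ((Scheme.Modules.pullback fB).obj ((Scheme.Modules.pullback hA).obj M)) (fB ⁻¹ᵁ (hA ⁻¹ᵁ V))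
            (unitSection fB ((Scheme.Modules.pullback hA).obj M) (hA ⁻¹ᵁ V) (unitSection hA M V m)) :=
        r1.trans (congrArg (fun y => unitSection g
          ((Scheme.Modules.pullback fB).obj ((Scheme.Modules.pullback hA).obj M)) (fB ⁻¹ᵁ (hA ⁻¹ᵁ V)) y) r2)
      exact (congrArg (fun y => (compCongrIso g fB rfl ((Scheme.Modules.pullback hA).obj M)).hom.app _ y) r12).trans r3
    exact L.trans R.symm
  -- apply `key` to `η_g s` and cancel `g^*(c⁻¹) (η_g s) = η_g (c⁻¹ s)`
  have hk := congrArg (fun ψ => Scheme.Modules.Hom.app ψ ⊤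
    (unitSection g ((Scheme.Modules.pullback (fB ≫ hA)).obj M) ⊤ s)) key
  simp only [Scheme.Modules.Hom.comp_app] at hk
  change (compCongrIso (g ≫ fB) hA rfl M).inv.app ⊤ ((compCongrIso g (fB ≫ hA) eqφ M).hom.app ⊤
      (unitSection g ((Scheme.Modules.pullback (fB ≫ hA)).obj M) ⊤ s)) =
    (compCongrIso g fB rfl ((Scheme.Modules.pullback hA).obj M)).hom.app ⊤
      (((Scheme.Modules.pullback g).map (compCongrIso fB hA rfl M).inv).app ⊤
        (unitSection g ((Scheme.Modules.pullback (fB ≫ hA)).obj M) ⊤ s)) at hk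
  exact hk.trans (congrArg (fun y => (compCongrIso g fB rfl ((Scheme.Modules.pullback hA).obj M)).hom.app ⊤ y)
    (pullback_map_app_unitSection g (compCongrIso fB hA rfl M).inv ⊤ s))

/-- `η|_{⊤ ≤ g⁻¹⊤} = η`: B-p10's restricted unit section along `⊤ ≤ g⁻¹⊤` is the unit section (generic; the two
sides live in `Γ(g^*N, ⊤) = Γ(g^*N, g⁻¹⊤)` definitionally). [folklore] [cite: Hartshorne1977, II.5 (p. 110)] -/
theorem unitSectionLE_le_top {Y₁ Y₂ : Scheme.{u}} (g : Y₁ ⟶ Y₂) (N : Y₂.Modules) (m : Γ(N, (⊤ : Y₂.Opens))) :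
    unitSectionLE g N (le_top : (⊤ : Y₁.Opens) ≤ g ⁻¹ᵁ ⊤) m = unitSection g N ⊤ m := by
  change ((Scheme.Modules.pullback g).obj N).presheaf.map
      (homOfLE (le_top : (⊤ : Y₁.Opens) ≤ ⊤)).op (unitSection g N ⊤ m) = unitSection g N ⊤ m
  rw [Subsingleton.elim (homOfLE (le_top : (⊤ : Y₁.Opens) ≤ ⊤)) (𝟙 _), op_id,
    CategoryTheory.Functor.map_id]
  rfl

/-- **`coherence_unitSection_top` with every module and isomorphism a free variable** pinned by (heterogeneous)
equations, so that an instantiation reproduces third-party spellings of the modules/isomorphisms token for token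
(the kernel then never has to unfold an applied pull-back isomorphism). [cite: Hartshorne1977, II.5 (p. 110)] -/
theorem coherence_unitSection_top_heq (hA : YA ⟶ Z) (fB : YB ⟶ YA) (g : YC ⟶ YB) {hB : YB ⟶ Z}
    (eqB : fB ≫ hA = hB) {fC : YC ⟶ YA} (eqF : g ≫ fB = fC) {hC : YC ⟶ Z} (eqC : fC ≫ hA = hC)
    (eqφ : g ≫ hB = hC) (M : Z.Modules)
    {N : YB.Modules} (hN : N = (Scheme.Modules.pullback hB).obj M)
    {P : YC.Modules} (hP : P = (Scheme.Modules.pullback hC).obj M)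
    {Q : YC.Modules} (hQ : Q = (Scheme.Modules.pullback fC).obj ((Scheme.Modules.pullback hA).obj M))
    {N' : YB.Modules} (hN' : N' = (Scheme.Modules.pullback fB).obj ((Scheme.Modules.pullback hA).obj M))
    {g' : YC ⟶ YB} (hg : g' = g)
    {P' : YC.Modules} (hP' : P' = (Scheme.Modules.pullback fC).obj ((Scheme.Modules.pullback hA).obj M))
    (e₁ : Q ≅ P) (he₁ : HEq e₁ (compCongrIso fC hA eqC M))
    (e₂ : (Scheme.Modules.pullback g).obj N ≅ P) (he₂ : HEq e₂ (compCongrIso g hB eqφ M))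
    (e₃ : (Scheme.Modules.pullback g').obj N' ≅ P')
    (he₃ : HEq e₃ (compCongrIso g fB eqF ((Scheme.Modules.pullback hA).obj M)))
    (e₄ : N' ≅ N) (he₄ : HEq e₄ (compCongrIso fB hA eqB M))
    (s : Γ(N, (⊤ : YB.Opens))) :
    HEq (e₁.inv.app ⊤ (e₂.hom.app ⊤ (unitSection g N ⊤ s)))
      (e₃.hom.app ⊤ (unitSection g' N' ⊤ (e₄.inv.app ⊤ s))) := by
  subst hN hP hQ hN' hP'
  subst g'
  have h₁ := eq_of_heq he₁
  have h₂ := eq_of_heq he₂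
  have h₃ := eq_of_heq he₃
  have h₄ := eq_of_heq he₄
  subst h₁ h₂ h₃ h₄
  exact heq_of_eq (coherence_unitSection_top hA fB g eqB eqF eqC eqφ M s)

end Literature.AlgebraicGeometry.Modules

end
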